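import Summits.ResolutionOfSingularities.ResolutionOfSingularities.Theorems.FrobeniusClosingCampaignW41Core4HahnValues
import Summits.ResolutionOfSingularities.ResolutionOfSingularities.Theorems.FrobeniusClosingCampaignW41Core4ValueGroup
import Summits.ResolutionOfSingularities.ResolutionOfSingularities.Theorems.FrobeniusClosingCampaignW41Core4Datum
import Literature.AlgebraicGeometry.Resolution.AffineDomainEquidim
import Literature.AlgebraicGeometry.Resolution.ValuedFunctionFields
import Literature.AlgebraicGeometry.Resolution.QuadraticTransforms
import Literature.AlgebraicGeometry.Resolution.RsopMonomialIdeals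
import Literature.AlgebraicGeometry.Resolution.LocalBlowup
import Mathlib.RingTheory.RegularLocalRing.Polynomial
import Mathlib.RingTheory.AlgebraicIndependent.TranscendenceBasis
import Mathlib.RingTheory.AlgebraicIndependent.Defs
import Mathlib.RingTheory.KrullDimension.Field
import HarnessLib

/-!
# Crux `Steer` (stmt-16345), chain W4.1 / kill test K4.1b: the dim-`≥ 4` Steer core is INHABITED (kernel certificate)

OURS (campaign `res-hironaka`, rung L, slot W4.1; replaces the role of no printed item; NOT a statement of
the manuscript under review). Final brick of the KERNEL inhabitant of the registered open stub
`Sig.stub_steerDefectCore4` (line `switching_dichotomy`, `Cruxes/Steer/Lines/switching_dichotomy.lean`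
l.233–256): `core4HypSatisfiable_four` proves, for EVERY prime `p`, the `∃`-closure of the twelve datum
hypotheses of the stub at transcendence degree `n = 4` — the kill-test object K4.1b of seat res-L0-k41
(tri-1's `Core4HypSatisfiable p 4`), stated Theses-free with the skeleton's vocabulary (`ZeroDim`,
`DenseAbhyankar`, `Discrete`, `IsFracOf`, `StronglySwitching`, `ArchSeq`, `Defect`) INLINED VERBATIM.

The datum (explicit up to two generic power series): `k = 𝔽_p`; `Ω = 𝔽_p⟦x^{ℤ[1/p]}⟧` with its order
valuation; `y = (x^p, θ₂^p, κ^p, θ₄^p)` with `κ` the Kuhlmann-type series of `…Core4HahnDefs` and `θ₂, θ₄`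
power series transcendental over the preceding countable subfields (`exists_independent_generators`);
`t = x θ₂ + κ^{p+1}` (so `t^p = y₁y₂ + y₃^{p+1}`); `K = 𝔽_p(y, t) ⊂ Ω`, `O = K ∩ 𝒪`, `A₀ = 𝔽_p[y]`.
Valuation side: residues in `𝔽_p` (`ZeroDim` by `X^p − X`); values of `Frac A₀` EXACTLY `ℤ[1/p]` (⊆ by the
ambient group, ⊇ by the elements `zElt j ^ p / y₁^{(j+1)p^{R j}}` of value `p^{-j}`), hence `p`-divisible,
which feeds res-L0-w41-stub-2's `core4Negatives_of_pDivisible` (¬Discrete, ¬DenseAbhyankar, ¬Abhyankar, Defect);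
algebraic side by stub-2's `core4Algebraic_of_datum`; regularity and dimension of the centre through
`A₀ ≅ MvPolynomial (Fin 4) 𝔽_p` (Mathlib `IsRegularRing`, tree `ringKrullDim_localization_atPrime_eq_of_isMaximal`);
`trdeg = 4` through `IsTranscendenceBasis`. No printed theorem is used as a hypothesis.
No `Theses.*` / `Cruxes.*` import (chain build rule). [folklore]
-/

-- layout-mandated namespace `Summit.<Summit>.<Problem>.…` with Summit = Problem (single-conjunct summit)
set_option linter.dupNamespace false

namespace Summit.ResolutionOfSingularities.ResolutionOfSingularities.Theorems.SwitchingDichotomy.Core4Hahn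

open Literature.AlgebraicGeometry.Resolution

variable (p : ℕ) [hp : Fact p.Prime]

/-! ## The kernel certificate, for an abstract field embedded in `Ω` -/

/-- **Assembly over an abstract field.** Let `K ⊇ 𝔽_p` be a field with an `𝔽_p`-embedding `ι : K → Ω`,
`yK : Fin 4 → K` algebraically independent with `ι (yK i)` of positive order, `tK ^ p = yK 0 * yK 1 + yK 2 ^ (p+1)`,
`K = 𝔽_p(yK, tK)`, and suppose every `γ ∈ ℤ[1/p]` is `p •` the value of a non-zero element of `𝔽_p(yK)`. Then
`O := ι⁻¹ 𝒪`, `A₀ := 𝔽_p[yK]`, `tK` satisfy ALL datum hypotheses of `Sig.stub_steerDefectCore4` at `n = 4`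
(skeleton vocabulary inlined verbatim). (Stated for an abstract `K` so that the subalgebra instance unifications
stay cheap; instantiated below with `K ⊂ Ω`.) [folklore] -/
theorem core4_of_embedding {K : Type} [Field K] [Algebra (ZMod p) K] (ι : K →ₐ[ZMod p] Ω p)
    (yK : Fin 4 → K) (tK : K) (hyKind : AlgebraicIndependent (ZMod p) yK)
    (hypos : ∀ i, 0 < (ι (yK i)).orderTop) (ht : tK ^ p = yK 0 * yK 1 + yK 2 ^ (p + 1))
    (htop : ∀ z : K, z ∈ IntermediateField.adjoin (ZMod p) (insert tK (Set.range yK)))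
    (hval : ∀ γ : PInv p, ∃ V : K, V ∈ IntermediateField.adjoin (ZMod p) (Set.range yK) ∧ V ≠ 0 ∧
      p • (ι V).order = γ) :
    ∃ (O : ValuationSubring K) (A₀ : Subalgebra (ZMod p) K) (h₀ : A₀.toSubring ≤ O.toSubring) (t : K)
      (_ : A₀.FG) (htp : t ^ p ∈ A₀),
      IsFractionRing (Algebra.adjoin (ZMod p) (insert t (A₀ : Set K))) K ∧
      IsRegularLocalRing (Localization.AtPrime
        (Ideal.comap (Subring.inclusion h₀) (IsLocalRing.maximalIdeal O))) ∧
      (Ideal.comap (Subring.inclusion h₀) (IsLocalRing.maximalIdeal O)).IsMaximal ∧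
      (∀ x ∈ O, ∃ f : Polynomial (ZMod p), f ≠ 0 ∧ Polynomial.aeval x f ∈ O.nonunits) ∧
      ¬ ringKrullDim (Localization.AtPrime
        (Ideal.comap (Subring.inclusion h₀) (IsLocalRing.maximalIdeal O))) ≤ 2 ∧
      ¬ IsAbhyankarPlace O (algebraMap (ZMod p) K).fieldRange ⊤ ∧
      ¬ (∃ F₀ : Subfield K, (algebraMap (ZMod p) K).fieldRange ≤ F₀ ∧ FGOver (algebraMap (ZMod p) K).fieldRange F₀ ∧
          IsAbhyankarPlace O (algebraMap (ZMod p) K).fieldRange F₀ ∧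
          ∀ x w : K, w ≠ 0 → ∃ a ∈ F₀, O.valuation (x - a) < O.valuation w) ∧
      ¬ (∃ π : K, π ≠ 0 ∧ O.valuation π < 1 ∧ ∀ z : K, z ≠ 0 → ∃ n : ℤ, O.valuation z = O.valuation π ^ n) ∧
      (∀ δ : Derivation ℤ (Localization.AtPrime (Ideal.comap (Subring.inclusion h₀)
          (IsLocalRing.maximalIdeal O))) (Localization.AtPrime (Ideal.comap (Subring.inclusion h₀)
          (IsLocalRing.maximalIdeal O))),
        ¬ IsUnit (δ (algebraMap A₀.toSubring (Localization.AtPrime (Ideal.comap (Subring.inclusion h₀)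
          (IsLocalRing.maximalIdeal O))) ⟨t ^ p, htp⟩))) ∧
      (∀ c : Localization.AtPrime (Ideal.comap (Subring.inclusion h₀) (IsLocalRing.maximalIdeal O)),
        algebraMap A₀.toSubring (Localization.AtPrime (Ideal.comap (Subring.inclusion h₀)
          (IsLocalRing.maximalIdeal O))) ⟨t ^ p, htp⟩ ≠ c ^ p) ∧
      Algebra.trdeg (ZMod p) K = ((4 : ℕ) : Cardinal) ∧
      ¬ ((∀ R : ℕ → Subring K, R 0 = locAtCentre A₀.toSubring O →
            (∀ i, IsQuadraticTransformAlong O (R i) (R (i + 1))) →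
            ∀ x : K, x ∈ O → (∃ y ∈ A₀, ∃ z ∈ A₀, z ≠ 0 ∧ x = y / z) → ∃ i, x ∈ R i) ∧
         (∀ R : ℕ → Subring K, R 0 = locAtCentre A₀.toSubring O →
            (∀ i, IsQuadraticTransformAlong O (R i) (R (i + 1))) →
            ∀ y : K, (∃ y' ∈ A₀, ∃ z ∈ A₀, z ≠ 0 ∧ y = y' / z) → y ≠ 0 → O.valuation y < 1 →
              ∃ (i : ℕ) (_ : IsLocalRing (R i)) (z : Fin 1 → R i), IsRsopPart z ∧
                ∃ n : ℕ, O.valuation ((z 0 : R i) : K) ^ n < O.valuation y) ∧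
         ¬ (∀ g : K, (∃ y ∈ A₀, ∃ z ∈ A₀, z ≠ 0 ∧ g = y / z) →
              ∃ w : K, (∃ y ∈ A₀, ∃ z ∈ A₀, z ≠ 0 ∧ w = y / z) ∧
                O.valuation (t ^ p - g ^ p) = O.valuation (w ^ p))) := by
  classical
  have hι : Function.Injective ι := ι.toRingHom.injective
  -- the valuation ring `O = ι⁻¹ 𝒪`
  obtain ⟨O, hO⟩ : ∃ O : ValuationSubring K,
      O = (𝒪 (PInv p) (ZMod p)).comap (ι : K →+* Ω p) := ⟨_, rfl⟩
  have hval_lt_one : ∀ a : K, O.valuation a < 1 ↔ 0 < (ι a).orderTop := fun a => by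
    rw [hO]; exact valuation_comap_lt_one_iff _ a
  have hval_eq : ∀ a b : K, O.valuation a = O.valuation b ↔ (ι a).orderTop = (ι b).orderTop :=
    fun a b => by rw [hO]; exact valuation_comap_eq_iff _ a b
  have hmemO : ∀ a : K, a ∈ O ↔ 0 ≤ (ι a).orderTop := fun a => by
    rw [hO]; exact mem_comap_𝒪_iff _ a
  -- `A₀ = 𝔽_p[yK] ⊆ O`
  have h₀ : (Algebra.adjoin (ZMod p) (Set.range yK)).toSubring ≤ O.toSubring := by
    let OB : Subalgebra (ZMod p) K :=
      { O.toSubring with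
        algebraMap_mem' := fun c => by
          show algebraMap (ZMod p) K c ∈ O
          rw [hmemO]
          by_cases hc : c = 0
          · rw [hc, map_zero, map_zero, HahnSeries.orderTop_zero]; exact le_top
          · have : ι (algebraMap (ZMod p) K c) = HahnSeries.C c := by
              rw [AlgHom.commutes, HahnSeries.C_eq_algebraMap]
            rw [this, HahnSeries.C_apply, HahnSeries.orderTop_single hc, WithTop.coe_zero] }
    have hle : Algebra.adjoin (ZMod p) (Set.range yK) ≤ OB := by
      refine Algebra.adjoin_le ?_
      rintro _ ⟨i, rfl⟩
      show yK i ∈ O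
      rw [hmemO]
      exact (hypos i).le
    intro z hz
    exact hle hz
  have hv : ∀ i, O.valuation (yK i) < 1 := fun i => by rw [hval_lt_one]; exact hypos i
  -- stub-2's ALGEBRAIC HALF
  obtain ⟨hfg, htp, hδ, hpow, hnp⟩ := core4Algebraic_of_datum p hp.out yK hyKind O h₀ hv
    (i := 0) (j := 1) (l := 2) (by decide) (by decide) tK ht
  -- `Frac (A₀[t]) = K`
  have hfr : IsFractionRing (Algebra.adjoin (ZMod p) (insert tK
      ((Algebra.adjoin (ZMod p) (Set.range yK) : Subalgebra (ZMod p) K) : Set K))) K := by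
    have hle : Algebra.adjoin (ZMod p) (insert tK (Set.range yK)) ≤ Algebra.adjoin (ZMod p) (insert tK
        ((Algebra.adjoin (ZMod p) (Set.range yK) : Subalgebra (ZMod p) K) : Set K)) :=
      Algebra.adjoin_mono (Set.insert_subset_insert Algebra.subset_adjoin)
    haveI : FaithfulSMul (Algebra.adjoin (ZMod p) (insert tK
        ((Algebra.adjoin (ZMod p) (Set.range yK) : Subalgebra (ZMod p) K) : Set K))) K :=
      (faithfulSMul_iff_algebraMap_injective _ K).mpr Subtype.val_injective
    refine IsFractionRing.of_field _ K fun z => ?_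
    obtain ⟨r, hr, s, hs, hrs⟩ := IntermediateField.mem_adjoin_iff_div.mp (htop z)
    exact ⟨⟨r, hle hr⟩, ⟨s, hle hs⟩, hrs⟩
  -- `K / 𝔽_p` is finitely generated as a field
  have hfgK : FGOver (algebraMap (ZMod p) K).fieldRange (⊤ : Subfield K) := by
    refine ⟨insert tK (Finset.univ.image yK), ?_⟩
    apply le_antisymm le_top
    intro z _
    have hz := htop z
    rw [← IntermediateField.mem_toSubfield, IntermediateField.adjoin_toSubfield] at hz
    refine Subfield.closure_mono ?_ hz
    apply Set.union_subset_union (le_of_eq rfl)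
    intro w hw
    rcases hw with rfl | ⟨i, rfl⟩
    · simp
    · simp
  -- `p`-DIVISIBILITY of the values of `Frac A₀`
  have hdivF : ∀ x : K, (∃ a ∈ Algebra.adjoin (ZMod p) (Set.range yK), ∃ s ∈ Algebra.adjoin (ZMod p)
      (Set.range yK), s ≠ 0 ∧ x = a / s) → x ≠ 0 →
      ∃ w : K, (∃ a ∈ Algebra.adjoin (ZMod p) (Set.range yK), ∃ s ∈ Algebra.adjoin (ZMod p)
        (Set.range yK), s ≠ 0 ∧ w = a / s) ∧ O.valuation x = O.valuation (w ^ p) := by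
    intro x _ hx0
    have hx0' : ι x ≠ 0 := fun h => hx0 (hι (by rw [h, map_zero]))
    obtain ⟨W, hW, hW0, hWord⟩ := hval (ι x).order
    refine ⟨W, ?_, ?_⟩
    · obtain ⟨r, hr, s, hs, hrs⟩ := IntermediateField.mem_adjoin_iff_div.mp hW
      by_cases hs0 : s = 0
      · refine ⟨0, Subalgebra.zero_mem _, 1, Subalgebra.one_mem _, one_ne_zero, ?_⟩
        rw [hrs, hs0, div_zero, zero_div]
      · exact ⟨r, hr, s, hs, hs0, hrs⟩
    · have hW0' : ι W ≠ 0 := fun h => hW0 (hι (by rw [h, map_zero]))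
      rw [hval_eq, ← HahnSeries.order_eq_orderTop_of_ne_zero hx0', map_pow,
        ← HahnSeries.order_eq_orderTop_of_ne_zero (pow_ne_zero _ hW0'), HahnSeries.order_pow, hWord]
  -- `O` is non-trivial on `K`
  have hnt : ∃ z : K, z ≠ 0 ∧ O.valuation z ≠ 1 := ⟨yK 0, hyKind.ne_zero 0, (hv 0).ne⟩
  -- stub-2's NEGATIVE HALF
  obtain ⟨hnD, hnd, hnA, hDef⟩ := core4Negatives_of_pDivisible p hp.out O
    (Algebra.adjoin (ZMod p) (Set.range yK)) h₀ tK htp hfr hfgK hdivF hnp hnt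
  -- `ZeroDim`, maximality of the centre
  have hzd : ∀ z : K, z ∈ O → ∃ f : Polynomial (ZMod p), f ≠ 0 ∧ Polynomial.aeval z f ∈ O.nonunits := by
    intro z hz
    refine ⟨Polynomial.X ^ p - Polynomial.X, FiniteField.X_pow_card_sub_X_ne_zero (ZMod p) hp.out.one_lt, ?_⟩
    rw [hO] at hz ⊢
    rw [mem_nonunits_comap_iff]
    have h1 : Polynomial.aeval z (Polynomial.X ^ p - Polynomial.X : Polynomial (ZMod p)) = z ^ p - z := by
      rw [map_sub, map_pow, Polynomial.aeval_X]
    rw [h1, RingHom.coe_coe, map_sub, map_pow]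
    exact orderTop_pow_char_sub_self_pos ((mem_comap_𝒪_iff _ _).mp hz)
  have hmax := isMaximal_centre_of_zeroDim' O hzd (Algebra.adjoin (ZMod p) (Set.range yK)) h₀
  -- regularity and dimension of the centre through `A₀ ≅ 𝔽_p[X₁..X₄]`
  have e₀ : MvPolynomial (Fin 4) (ZMod p) ≃+* (Algebra.adjoin (ZMod p) (Set.range yK) : Subalgebra (ZMod p) K) :=
    hyKind.aevalEquiv.toRingEquiv
  have e₁ : (Algebra.adjoin (ZMod p) (Set.range yK) : Subalgebra (ZMod p) K) ≃+*
      (Algebra.adjoin (ZMod p) (Set.range yK)).toSubring :=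
    { toFun := fun a => ⟨a.1, a.2⟩
      invFun := fun a => ⟨a.1, a.2⟩
      left_inv := fun _ => rfl
      right_inv := fun _ => rfl
      map_mul' := fun _ _ => rfl
      map_add' := fun _ _ => rfl }
  have e := e₀.trans e₁
  haveI : IsRegularRing (MvPolynomial (Fin 4) (ZMod p)) := inferInstance
  haveI hRR : IsRegularRing (Algebra.adjoin (ZMod p) (Set.range yK)).toSubring := IsRegularRing.of_ringEquiv e
  haveI hprime : (Ideal.comap (Subring.inclusion h₀) (IsLocalRing.maximalIdeal O)).IsMaximal := hmax
  have hreg : IsRegularLocalRing (Localization.AtPrime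
      (Ideal.comap (Subring.inclusion h₀) (IsLocalRing.maximalIdeal O))) := inferInstance
  have hdim2 : ¬ ringKrullDim (Localization.AtPrime
      (Ideal.comap (Subring.inclusion h₀) (IsLocalRing.maximalIdeal O))) ≤ 2 := by
    letI : Algebra (ZMod p) (Algebra.adjoin (ZMod p) (Set.range yK)).toSubring :=
      (Algebra.adjoin (ZMod p) (Set.range yK)).algebra
    haveI : Algebra.FiniteType (ZMod p) (Algebra.adjoin (ZMod p) (Set.range yK)).toSubring :=
      (Subalgebra.fg_iff_finiteType _).mp hfg
    rw [ringKrullDim_localization_atPrime_eq_of_isMaximal (ZMod p)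
      (Ideal.comap (Subring.inclusion h₀) (IsLocalRing.maximalIdeal O)), ← ringKrullDim_eq_of_ringEquiv e,
      MvPolynomial.ringKrullDim_of_isNoetherianRing, ringKrullDim_eq_zero_of_field, zero_add]
    have h4 : (Nat.card (Fin 4) : WithBot ℕ∞) = ((4 : ℕ) : WithBot ℕ∞) := by
      rw [Nat.card_eq_fintype_card, Fintype.card_fin]
    rw [h4]
    intro h
    have h' : (4 : ℕ) ≤ 2 := by
      have h2 : ((4 : ℕ) : WithBot ℕ∞) ≤ ((2 : ℕ) : WithBot ℕ∞) := by simpa using h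
      exact_mod_cast h2
    omega
  -- `trdeg = 4`: every element of `K` is algebraic over `A₀` (the algebraic elements form a subfield
  -- containing the generators), so `yK` is a transcendence basis
  have halg : Algebra.IsAlgebraic (Algebra.adjoin (ZMod p) (Set.range yK)) K := by
    let T : Subfield K :=
      { (Subalgebra.algebraicClosure (Algebra.adjoin (ZMod p) (Set.range yK)) K).toSubring with
        inv_mem' := fun z hz => IsAlgebraic.inv hz }
    have hT : ∀ z : K, z ∈ T ↔ IsAlgebraic (Algebra.adjoin (ZMod p) (Set.range yK)) z := fun z => Iff.rfl
    have hgen : (IntermediateField.adjoin (ZMod p) (insert tK (Set.range yK))).toSubfield ≤ T := by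
      rw [IntermediateField.adjoin_toSubfield]
      refine Subfield.closure_le.mpr ?_
      rintro w (⟨c, rfl⟩ | hw | ⟨i, rfl⟩)
      · rw [SetLike.mem_coe, hT, IsScalarTower.algebraMap_apply (ZMod p)
          (Algebra.adjoin (ZMod p) (Set.range yK)) K c]
        exact isAlgebraic_algebraMap _
      · rw [SetLike.mem_coe, hT, hw]
        refine ⟨Polynomial.X ^ p - Polynomial.C ⟨tK ^ p, htp⟩, Polynomial.X_pow_sub_C_ne_zero hp.out.pos _, ?_⟩
        rw [map_sub, map_pow, Polynomial.aeval_X, Polynomial.aeval_C]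
        exact sub_self _
      · rw [SetLike.mem_coe, hT]
        exact isAlgebraic_algebraMap (⟨yK i, Algebra.subset_adjoin ⟨i, rfl⟩⟩ :
          Algebra.adjoin (ZMod p) (Set.range yK))
    exact ⟨fun z => (hT z).mp (hgen ((IntermediateField.mem_toSubfield _ _).mpr (htop z)))⟩
  have hbasis : IsTranscendenceBasis (ZMod p) yK :=
    (AlgebraicIndependent.isTranscendenceBasis_iff_isAlgebraic hyKind).mpr halg
  have htr : Algebra.trdeg (ZMod p) K = ((4 : ℕ) : Cardinal) := by
    rw [← hbasis.cardinalMk_eq_trdeg, Cardinal.mk_fin]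
  -- assemble
  exact ⟨O, Algebra.adjoin (ZMod p) (Set.range yK), h₀, tK, hfg, htp, hfr, hreg, hmax, hzd, hdim2, hnA, hnd,
    hnD, hδ, hpow, htr, fun ⟨_, _, hnDef⟩ => hnDef hDef⟩

/-! ## The kernel certificate -/

/-- **The registered dim-`≥ 4` Steer core is INHABITED at `(p, 4)` for every prime `p` (K4.1b, kernel form).**
There exist a perfect field `k` of characteristic `p` (namely `𝔽_p`), a field `K ⊇ k`, a valuation ring `O` of
`K`, a finitely generated `k`-subalgebra `A₀ ⊆ O` and `t ∈ K` with `t ^ p ∈ A₀` satisfying ALL datum hypotheses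
of `Sig.stub_steerDefectCore4` with `trdeg_k K = 4`: `Frac (A₀[t]) = K`; `A₀` regular at the centre of `O`; the
centre maximal; `O` zero-dimensional over `k`; centre of dimension `> 2`; `O` NOT an Abhyankar place of `K/k`;
`K` NOT dense in any finitely generated Abhyankar subfunction field; `O` NOT discrete of rank one; no unit
`ℤ`-derivative of `t ^ p` and `t ^ p` not a `p`-th power at the centre; and NOT (strongly switching ∧
parameter-archimedean ∧ defectless) — indeed with DEFECT. The skeleton's vocabulary is inlined verbatim, so the
chain's leaf obtains tri-1's `Core4HypSatisfiable p 4` by `exact`. OURS; replaces the role of no printed item;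
every ingredient is an explicit construction (Hahn series over `𝔽_p`), no published theorem is assumed. [folklore] -/
theorem core4HypSatisfiable_four :
    ∃ (k K : Type) (_ : Field k) (_ : CharP k p) (_ : PerfectField k) (_ : Field K) (_ : Algebra k K)
      (O : ValuationSubring K) (A₀ : Subalgebra k K) (h₀ : A₀.toSubring ≤ O.toSubring) (t : K)
      (_ : A₀.FG) (htp : t ^ p ∈ A₀),
      IsFractionRing (Algebra.adjoin k (insert t (A₀ : Set K))) K ∧
      IsRegularLocalRing (Localization.AtPrime
        (Ideal.comap (Subring.inclusion h₀) (IsLocalRing.maximalIdeal O))) ∧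
      (Ideal.comap (Subring.inclusion h₀) (IsLocalRing.maximalIdeal O)).IsMaximal ∧
      (∀ x ∈ O, ∃ f : Polynomial k, f ≠ 0 ∧ Polynomial.aeval x f ∈ O.nonunits) ∧
      ¬ ringKrullDim (Localization.AtPrime
        (Ideal.comap (Subring.inclusion h₀) (IsLocalRing.maximalIdeal O))) ≤ 2 ∧
      ¬ IsAbhyankarPlace O (algebraMap k K).fieldRange ⊤ ∧
      ¬ (∃ F₀ : Subfield K, (algebraMap k K).fieldRange ≤ F₀ ∧ FGOver (algebraMap k K).fieldRange F₀ ∧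
          IsAbhyankarPlace O (algebraMap k K).fieldRange F₀ ∧
          ∀ x w : K, w ≠ 0 → ∃ a ∈ F₀, O.valuation (x - a) < O.valuation w) ∧
      ¬ (∃ π : K, π ≠ 0 ∧ O.valuation π < 1 ∧ ∀ z : K, z ≠ 0 → ∃ n : ℤ, O.valuation z = O.valuation π ^ n) ∧
      (∀ δ : Derivation ℤ (Localization.AtPrime (Ideal.comap (Subring.inclusion h₀)
          (IsLocalRing.maximalIdeal O))) (Localization.AtPrime (Ideal.comap (Subring.inclusion h₀)
          (IsLocalRing.maximalIdeal O))),
        ¬ IsUnit (δ (algebraMap A₀.toSubring (Localization.AtPrime (Ideal.comap (Subring.inclusion h₀)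
          (IsLocalRing.maximalIdeal O))) ⟨t ^ p, htp⟩))) ∧
      (∀ c : Localization.AtPrime (Ideal.comap (Subring.inclusion h₀) (IsLocalRing.maximalIdeal O)),
        algebraMap A₀.toSubring (Localization.AtPrime (Ideal.comap (Subring.inclusion h₀)
          (IsLocalRing.maximalIdeal O))) ⟨t ^ p, htp⟩ ≠ c ^ p) ∧
      Algebra.trdeg k K = ((4 : ℕ) : Cardinal) ∧
      ¬ ((∀ R : ℕ → Subring K, R 0 = locAtCentre A₀.toSubring O →
            (∀ i, IsQuadraticTransformAlong O (R i) (R (i + 1))) →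
            ∀ x : K, x ∈ O → (∃ y ∈ A₀, ∃ z ∈ A₀, z ≠ 0 ∧ x = y / z) → ∃ i, x ∈ R i) ∧
         (∀ R : ℕ → Subring K, R 0 = locAtCentre A₀.toSubring O →
            (∀ i, IsQuadraticTransformAlong O (R i) (R (i + 1))) →
            ∀ y : K, (∃ y' ∈ A₀, ∃ z ∈ A₀, z ≠ 0 ∧ y = y' / z) → y ≠ 0 → O.valuation y < 1 →
              ∃ (i : ℕ) (_ : IsLocalRing (R i)) (z : Fin 1 → R i), IsRsopPart z ∧
                ∃ n : ℕ, O.valuation ((z 0 : R i) : K) ^ n < O.valuation y) ∧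
         ¬ (∀ g : K, (∃ y ∈ A₀, ∃ z ∈ A₀, z ≠ 0 ∧ g = y / z) →
              ∃ w : K, (∃ y ∈ A₀, ∃ z ∈ A₀, z ≠ 0 ∧ w = y / z) ∧
                O.valuation (t ^ p - g ^ p) = O.valuation (w ^ p))) := by
  classical
  obtain ⟨θ₂, θ₄, hθ₂, hθ₂0, hθ₄, hθ₄0, hind⟩ := exists_independent_generators p
  -- the generators and the radicand's root in `Ω`
  set y : Fin 4 → Ω p := ![xElt p ^ p, θ₂ ^ p, kser p ^ p, θ₄ ^ p] with hy
  set tΩ : Ω p := xElt p * θ₂ + kser p ^ (p + 1) with htΩ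
  have hy0 : y 0 = xElt p ^ p := rfl
  have hy1 : y 1 = θ₂ ^ p := rfl
  have hy2 : y 2 = kser p ^ p := rfl
  have hypos : ∀ i, 0 < (y i).orderTop := by
    intro i
    fin_cases i
    · exact orderTop_xPow_pos p
    · exact orderTop_pow_pos hθ₂ hp.out.ne_zero
    · exact orderTop_kserPow_pos p
    · exact orderTop_pow_pos hθ₄ hp.out.ne_zero
  have htpow : tΩ ^ p = y 0 * y 1 + y 2 ^ (p + 1) := by
    haveI := charP_Ω p
    rw [htΩ, hy0, hy1, hy2, add_pow_char, mul_pow, ← pow_mul, ← pow_mul, mul_comm (p + 1) p]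
  -- the field `K = 𝔽_p(y, t) ⊂ Ω`
  obtain ⟨Kf, hKf⟩ : ∃ Kf : IntermediateField (ZMod p) (Ω p),
      Kf = IntermediateField.adjoin (ZMod p) (insert tΩ (Set.range y)) := ⟨_, rfl⟩
  have hymem : ∀ i, y i ∈ Kf := fun i => by
    rw [hKf]; exact IntermediateField.subset_adjoin _ _ (Set.mem_insert_of_mem _ ⟨i, rfl⟩)
  have htmem : tΩ ∈ Kf := by rw [hKf]; exact IntermediateField.subset_adjoin _ _ (Set.mem_insert _ _)
  obtain ⟨yK, hyK⟩ : ∃ yK : Fin 4 → Kf, ∀ i, ((yK i : Kf) : Ω p) = y i := ⟨fun i => ⟨y i, hymem i⟩, fun i => rfl⟩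
  obtain ⟨tK, htK⟩ : ∃ tK : Kf, ((tK : Kf) : Ω p) = tΩ := ⟨⟨tΩ, htmem⟩, rfl⟩
  have hcomp : (Kf.val : Kf → Ω p) ∘ yK = y := funext fun i => by
    simp only [Function.comp_apply, IntermediateField.coe_val, hyK]
  -- every element of `K` lies in `𝔽_p(yK, tK)` (read back from `Ω`)
  have htop : ∀ z : Kf, z ∈ IntermediateField.adjoin (ZMod p) (insert tK (Set.range yK)) := by
    intro z
    have hmap : (IntermediateField.adjoin (ZMod p) (insert tK (Set.range yK))).map Kf.val = Kf := by
      rw [IntermediateField.adjoin_map, Set.image_insert_eq, ← Set.range_comp, hcomp, IntermediateField.coe_val,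
        htK, ← hKf]
    have hz : (z : Ω p) ∈ (IntermediateField.adjoin (ZMod p) (insert tK (Set.range yK))).map Kf.val := by
      rw [hmap]; exact z.2
    rw [IntermediateField.mem_map] at hz
    obtain ⟨w, hw, hwz⟩ := hz
    rw [IntermediateField.coe_val] at hwz
    rwa [← Subtype.ext hwz]
  -- algebraic independence of `yK`
  have hyKind : AlgebraicIndependent (ZMod p) yK := by
    refine AlgebraicIndependent.of_comp Kf.val ?_
    rw [hcomp, hy]
    exact hind
  have hyposK : ∀ i, 0 < (Kf.val (yK i)).orderTop := fun i => by
    rw [IntermediateField.coe_val]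
    show 0 < ((yK i : Kf) : Ω p).orderTop
    rw [hyK]; exact hypos i
  have ht : tK ^ p = yK 0 * yK 1 + yK 2 ^ (p + 1) := by
    apply Subtype.ext
    simp only [SubmonoidClass.coe_pow, MulMemClass.coe_mul, AddMemClass.coe_add, htK, hyK]
    exact htpow
  -- the value witnesses, read inside `K`
  have hval : ∀ γ : PInv p, ∃ V : Kf, V ∈ IntermediateField.adjoin (ZMod p) (Set.range yK) ∧ V ≠ 0 ∧
      p • (Kf.val V).order = γ := by
    intro γ
    obtain ⟨V, hV, hV0, hVord⟩ := exists_nsmul_order_eq p γ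
    have hVK : V ∈ (IntermediateField.adjoin (ZMod p) (Set.range yK)).map Kf.val := by
      rw [IntermediateField.adjoin_map]
      have hsub : ({xElt p ^ p, kser p ^ p} : Set (Ω p)) ⊆ Kf.val '' Set.range yK := by
        intro w hw
        rcases hw with rfl | rfl
        · exact ⟨yK 0, ⟨0, rfl⟩, by rw [IntermediateField.coe_val, hyK]; rfl⟩
        · exact ⟨yK 2, ⟨2, rfl⟩, by rw [IntermediateField.coe_val, hyK]; rfl⟩
      exact IntermediateField.adjoin.mono _ _ _ hsub hV
    rw [IntermediateField.mem_map] at hVK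
    obtain ⟨W, hW, hWV⟩ := hVK
    refine ⟨W, hW, fun h => hV0 (by rw [← hWV, h, map_zero]), ?_⟩
    rw [hWV]; exact hVord
  obtain ⟨O, A₀, h₀, t, hfg, htp, H⟩ := core4_of_embedding p Kf.val yK tK hyKind hyposK ht htop hval
  exact ⟨ZMod p, Kf, inferInstance, inferInstance, inferInstance, inferInstance, inferInstance, O, A₀, h₀, t,
    hfg, htp, H⟩

end Summit.ResolutionOfSingularities.ResolutionOfSingularities.Theorems.SwitchingDichotomy.Core4Hahn
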